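import Literature.AlgebraicGeometry.HodgeTheory.PolarizationClassRosatiAdjoint
import Literature.AlgebraicGeometry.HodgeTheory.WeilClassesFieldTypeFourTotallyRealIsogenousPowers
import HarnessLib

/-!
# Moonen–Zarhin's Criterion (2), type 4, relative to a totally real field: for `Y` simple of type IV and every
# `X ∼ Y^m`, the Weil classes `W_F(X)` of a TOTALLY REAL `F ⊆ End⁰(X)` are decomposable Hodge classes — intrinsically

Layer `Literature/AlgebraicGeometry/HodgeTheory`; THEOREMS ONLY — no definition, no named fact, no `sorry` (D-0026, net
debt 0).  Assembly row: the seat's `WeilClassesFieldTypeFourTotallyRealDecomposable` (g27-#3) and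
`WeilClassesFieldTypeFourTotallyRealIsogenousPowers` (g27-#4) proved «type 4, `F` totally real ⟹ `W_F` consists of
decomposable Hodge classes» for every `Z` isogenous to `A^{n+1}` from the `End(A)`-level type-4 DATUM (a polarization
class `h` of `A`; the centre of `End⁰(A)` presented as `ℚ(ψ)` on `End(A)`; the Rosati image `ψ'` of `ψ` with
`ψ' ≠ ψ`).  For `A = B` SIMPLE that datum is a theorem of the tree (g28-#1/#2:
`exists_polarizationClass_centre_presentation_End_with_rosati_of_isSimple`, and `ψ' ≠ ψ ↔ IsCMField (Z(End⁰ B))` by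
`adjoint_ne_iff_not_hasNoTypeIVFactor` + `not_hasNoTypeIVFactor_iff_isCMField_centerField`), so the statement holds
with NO hypothesis on `B` beyond simplicity and type IV (CM centre).

## The print

B. J. J. Moonen, Yu. G. Zarhin, *Weil classes on abelian varieties* [MoonenZarhin1998WeilClasses] (held text
`paper:arxiv-alg-geom_9612017`), §1 (chunk p0002 L45–L51: «`X = Y^m` … `Y` simple … `E` the center of `D` … `E₀` the
maximal totally real subfield»), Criterion (chunk p0003 L59–L80), case «`Y` is of Type 4 … and the map
`θ : E₋ ↪ End_F(V_X) —Tr_F→ F` … is non-zero» — for `F` totally real `θ = 0` (the trace of a `†`-skew central element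
is purely imaginary), so `W_F` contains no exceptional classes; with Criterion (1) (section (crit1): `W_F` consists of
Hodge classes iff `n_σ = n_σ̄`, automatic for real `σ`).  P. Deligne, *Hodge cycles on abelian varieties*, LNM 900
(1982) [Deligne1982HodgeCycles] Prop. 4.4.  H. Lange (2023) [Lange2023AbelianVarietiesC] §2.6 Lemma 2.6.6 (type IV:
`†` is complex conjugation on the CM centre).

## What is proved (sorry-free), for `B` simple of positive dimension with `IsCMField (CenterField B)` (type IV),
## `Z` with `B^{n+1} ∼ Z` (any `n ≥ 0`), `F = ℚ(φ) ⊆ End⁰(Z)` totally real (`P(φ) = 0`, `P ∈ ℤ[X]` monic irreducible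
## with only real roots, `deg P · 2m = 2 dim Z`, `m ≠ 0`)

* **`AbelianVariety.IsSimple.weilClassesField_le_divisorClassesSpan_of_isCMField_centerField_of_forall_root_im_eq_zero`**
  — `W_F(Z) ⊗ ℂ ≤ 𝒟ᵐ(Z) ⊗ ℂ`;
* **`….weilClassesField_le_hodgeClassSpan_and_le_divisorClassesSpan_of_isCMField_centerField_of_forall_root_im_eq_zero`**
  — `W_F(Z) ⊗ ℂ ≤ Bᵐ(Z) ⊗ ℂ` and `≤ 𝒟ᵐ(Z) ⊗ ℂ`: decomposable Hodge classes, NO exceptional Weil–Hodge classes;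
* `…_of_not_hasNoTypeIVFactor_…` — the same from «`B` has a factor of type IV»;
* `….weilClassesField_biproduct_le_divisorClassesSpan_…` — `Z = B^{n+1}` itself; `….weilClassesField_le_divisorClassesSpan_
  of_isCMField_centerField_of_forall_root_im_eq_zero_self` — `Z ∼ B` (`m = 1`).

## Honest column

* Only the totally-real-`F` half of the type-4 criterion is intrinsic here; the «`θ ≠ 0`» half (exceptional classes)
  is stated in the tree relative to the datum `(h, ψ, ψ')` (`WeilClassesFieldTypeFourExceptionalHodgeClasses`,
  `WeilClassesFieldIsogenousPowersExceptionalHodgeClasses`), whose eigenvalue conditions mention `ψ` itself.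
* `W_F`, `Bᵐ`, `𝒟ᵐ` are the tree's `weilClassesField`, `hodgeClassSpan`, `divisorClassesSpan` on `H^{2m}(Z(ℂ); ℂ)`.

## Provenance

Lane `lit-hodgefound` (Track 2, Layer A), prover seat `lit-hodgefound-p21` (generation 28), row g28-#4.
-/

noncomputable section

open CategoryTheory CategoryTheory.Limits Polynomial Module NumberField
open Literature.AlgebraicTopology.SingularHomology
open Literature.AlgebraicGeometry.Motives
open Literature.AlgebraicGeometry.VanGeemen1994 (hodgeClassSpan pullbackOne)
open Literature.AlgebraicGeometry.Milne1999
open Literature.Barriers.HodgeConjecture (divisorClassesSpan)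
open Literature.AlgebraicGeometry.ComplexMultiplication (CenterField)
open Literature.Geometry.Kaehler (lefschetzPow HasHardLefschetzProperty)

namespace Literature.AlgebraicGeometry.Motives.AbelianVariety.IsSimple

open Literature.AlgebraicGeometry.HodgeTheory

variable {B Z : AbelianVariety ℂ} {n e m : ℕ} {φ : Z ⟶ Z} {P : Polynomial ℤ}

/-- **MOONEN–ZARHIN, CRITERION (2), TYPE 4, TOTALLY REAL `F` — INTRINSIC FORM**: for `B` simple of positive dimension whose
endomorphism algebra has CM centre (type IV), every `Z` with `B^{n+1} ∼ Z` and every totally real `F = ℚ(φ) ⊆ End⁰(Z)`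
(`P(φ) = 0`, `P` monic irreducible over `ℚ` with only real roots, `deg P · 2m = 2 dim Z`, `m ≠ 0`):
`W_F(Z) ⊗ ℂ ≤ 𝒟ᵐ(Z) ⊗ ℂ` — the Weil classes of `F` are `ℂ`-combinations of products of divisor classes.  The
`End(B)`-level datum of the seat's `weilClassesField_le_divisorClassesSpan_of_forall_root_im_eq_zero_of_isIsogenous_
biproduct_of_CMCentre_End` is supplied by `exists_polarizationClass_centre_presentation_End_with_rosati_of_isSimple`.
[cite: MoonenZarhin1998WeilClasses, §1 (chunk p0002 L45–L51), Criterion (2), case «Type 4 … the map θ … is non-zero» (chunk p0003 L59–L80, L97–L106) and Remarks (2)–(3) (chunk p0004 L78–L110)]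
[cite: Lange2023AbelianVarietiesC, §2.6 Lemma 2.6.6 (held p0144)] [cite: Deligne1982HodgeCycles, Prop. 4.4] -/
theorem weilClassesField_le_divisorClassesSpan_of_isCMField_centerField_of_forall_root_im_eq_zero
    (hB : AbelianVariety.IsSimple B) (h1 : 1 ≤ B.dim) (hK : IsCMField (CenterField B hB h1))
    (hXZ : AbelianVariety.IsIsogenous (⨁ (fun _ : Fin (n + 1) => B)) Z)
    (hPm : P.Monic) (hPe : P.natDegree = e) (hPirr : Irreducible (P.map (Int.castRingHom ℚ)))
    (hφ : Polynomial.eval₂ (Int.castRingHom (CategoryTheory.End Z)) (End.of φ) P = 0)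
    (her : e * (2 * m) = 2 * Z.dim) (hm : m ≠ 0)
    (hreal : ∀ ρ : ℂ, Polynomial.eval₂ (Int.castRingHom ℂ) ρ P = 0 → ρ.im = 0) :
    weilClassesField Z φ P (2 * m) ≤ divisorClassesSpan Z.X Z.dim m := by
  obtain ⟨h, ψ, ψ', R, hQ, h11, hHL, hposQ, -, htop, hnd, hψ, hRm, hRirr, hψR, -, hZ, hadj, -, hψ'E⟩ :=
    exists_polarizationClass_centre_presentation_End_with_rosati_of_isSimple hB h1
  have hne : ψ' ≠ ψ := (adjoint_ne_iff_not_hasNoTypeIVFactor h1 hnd hposQ hψ hRm hRirr hψR hadj hψ'E hZ).2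
    ((not_hasNoTypeIVFactor_iff_isCMField_centerField hB h1).2 hK)
  exact weilClassesField_le_divisorClassesSpan_of_forall_root_im_eq_zero_of_isIsogenous_biproduct_of_CMCentre_End h1 hQ h11
    hHL htop hposQ hψ hRm hRirr hψR hadj hψ'E hne hZ hXZ hPm hPe hPirr hφ her hm hreal

/-- **… AND `W_F(Z) ⊗ ℂ` CONSISTS OF DECOMPOSABLE HODGE CLASSES**: `W_F(Z) ⊗ ℂ ≤ Bᵐ(Z) ⊗ ℂ` (Criterion (1): `n_ρ = n_ρ̄`
trivially for real `ρ`) and `≤ 𝒟ᵐ(Z) ⊗ ℂ` — in type 4 there are NO exceptional Weil–Hodge classes relative to a totally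
real field, for any `Z` in the isogeny class of a power of the simple `B`.
[cite: MoonenZarhin1998WeilClasses, §1 Criterion (1) (section (crit1)) and Criterion (2), case «Type 4» (chunk p0003 L59–L80)]
[cite: Deligne1982HodgeCycles, Prop. 4.4] -/
theorem weilClassesField_le_hodgeClassSpan_and_le_divisorClassesSpan_of_isCMField_centerField_of_forall_root_im_eq_zero
    (hB : AbelianVariety.IsSimple B) (h1 : 1 ≤ B.dim) (hK : IsCMField (CenterField B hB h1))
    (hXZ : AbelianVariety.IsIsogenous (⨁ (fun _ : Fin (n + 1) => B)) Z)
    (hPm : P.Monic) (hPe : P.natDegree = e) (hPirr : Irreducible (P.map (Int.castRingHom ℚ)))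
    (hφ : Polynomial.eval₂ (Int.castRingHom (CategoryTheory.End Z)) (End.of φ) P = 0)
    (her : e * (2 * m) = 2 * Z.dim) (hm : m ≠ 0)
    (hreal : ∀ ρ : ℂ, Polynomial.eval₂ (Int.castRingHom ℂ) ρ P = 0 → ρ.im = 0) :
    weilClassesField Z φ P (2 * m) ≤ hodgeClassSpan Z.dim Z.X m ∧
      weilClassesField Z φ P (2 * m) ≤ divisorClassesSpan Z.X Z.dim m :=
  ⟨(Deligne1982.weilClassesField_le_hodgeClassSpan_iff_forall_eigenMultiplicity_eq hPm hPe hPirr hφ her).2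
      fun ρ hρ ↦ by rw [Complex.conj_eq_iff_im.2 (hreal ρ hρ)],
    hB.weilClassesField_le_divisorClassesSpan_of_isCMField_centerField_of_forall_root_im_eq_zero h1 hK hXZ hPm hPe hPirr hφ
      her hm hreal⟩

/-- **… the same from «`B` has a factor of type IV»** (`¬ HasNoTypeIVFactor B`).
[cite: MoonenZarhin1998WeilClasses, §1 Criterion (2), case «Type 4» (chunk p0003 L59–L80)] [cite: Lange2023AbelianVarietiesC, §2.6 Lemma 2.6.6 (held p0144)] -/
theorem weilClassesField_le_hodgeClassSpan_and_le_divisorClassesSpan_of_not_hasNoTypeIVFactor_of_forall_root_im_eq_zero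
    (hB : AbelianVariety.IsSimple B) (h1 : 1 ≤ B.dim) (h4 : ¬ HasNoTypeIVFactor B)
    (hXZ : AbelianVariety.IsIsogenous (⨁ (fun _ : Fin (n + 1) => B)) Z)
    (hPm : P.Monic) (hPe : P.natDegree = e) (hPirr : Irreducible (P.map (Int.castRingHom ℚ)))
    (hφ : Polynomial.eval₂ (Int.castRingHom (CategoryTheory.End Z)) (End.of φ) P = 0)
    (her : e * (2 * m) = 2 * Z.dim) (hm : m ≠ 0)
    (hreal : ∀ ρ : ℂ, Polynomial.eval₂ (Int.castRingHom ℂ) ρ P = 0 → ρ.im = 0) :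
    weilClassesField Z φ P (2 * m) ≤ hodgeClassSpan Z.dim Z.X m ∧
      weilClassesField Z φ P (2 * m) ≤ divisorClassesSpan Z.X Z.dim m :=
  hB.weilClassesField_le_hodgeClassSpan_and_le_divisorClassesSpan_of_isCMField_centerField_of_forall_root_im_eq_zero h1
    ((not_hasNoTypeIVFactor_iff_isCMField_centerField hB h1).1 h4) hXZ hPm hPe hPirr hφ her hm hreal

/-- **The powers `Z = B^{n+1}` themselves.** [cite: MoonenZarhin1998WeilClasses, §1 Criterion (2), case «Type 4» (chunk p0003 L59–L80)] -/
theorem weilClassesField_biproduct_le_divisorClassesSpan_of_isCMField_centerField_of_forall_root_im_eq_zero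
    (hB : AbelianVariety.IsSimple B) (h1 : 1 ≤ B.dim) (hK : IsCMField (CenterField B hB h1))
    {φ : (⨁ (fun _ : Fin (n + 1) => B)) ⟶ ⨁ (fun _ : Fin (n + 1) => B)}
    (hPm : P.Monic) (hPe : P.natDegree = e) (hPirr : Irreducible (P.map (Int.castRingHom ℚ)))
    (hφ : Polynomial.eval₂ (Int.castRingHom (CategoryTheory.End (⨁ (fun _ : Fin (n + 1) => B)))) (End.of φ) P = 0)
    (her : e * (2 * m) = 2 * (⨁ (fun _ : Fin (n + 1) => B)).dim) (hm : m ≠ 0)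
    (hreal : ∀ ρ : ℂ, Polynomial.eval₂ (Int.castRingHom ℂ) ρ P = 0 → ρ.im = 0) :
    weilClassesField (⨁ (fun _ : Fin (n + 1) => B)) φ P (2 * m) ≤
      divisorClassesSpan (⨁ (fun _ : Fin (n + 1) => B)).X (⨁ (fun _ : Fin (n + 1) => B)).dim m :=
  hB.weilClassesField_le_divisorClassesSpan_of_isCMField_centerField_of_forall_root_im_eq_zero h1 hK
    (AbelianVariety.IsIsogenous.refl _) hPm hPe hPirr hφ her hm hreal

/-- **`m = 1`: `Z ∼ B` itself** (through `B^1 = ⨁_{Fin 1} B ∼ B`).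
[cite: MoonenZarhin1998WeilClasses, §1 Criterion (2), case «Type 4» (chunk p0003 L59–L80) and «everything only depends on X up to isogeny» (chunk p0002 L45)] -/
theorem weilClassesField_le_divisorClassesSpan_of_isCMField_centerField_of_forall_root_im_eq_zero_self
    (hB : AbelianVariety.IsSimple B) (h1 : 1 ≤ B.dim) (hK : IsCMField (CenterField B hB h1))
    (hBZ : AbelianVariety.IsIsogenous B Z)
    (hPm : P.Monic) (hPe : P.natDegree = e) (hPirr : Irreducible (P.map (Int.castRingHom ℚ)))
    (hφ : Polynomial.eval₂ (Int.castRingHom (CategoryTheory.End Z)) (End.of φ) P = 0)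
    (her : e * (2 * m) = 2 * Z.dim) (hm : m ≠ 0)
    (hreal : ∀ ρ : ℂ, Polynomial.eval₂ (Int.castRingHom ℂ) ρ P = 0 → ρ.im = 0) :
    weilClassesField Z φ P (2 * m) ≤ divisorClassesSpan Z.X Z.dim m :=
  hB.weilClassesField_le_divisorClassesSpan_of_isCMField_centerField_of_forall_root_im_eq_zero (n := 0) h1 hK
    ((ComplexMultiplication.isIsogenous_biproduct_powSucc B 0).trans hBZ) hPm hPe hPirr hφ her hm hreal

end Literature.AlgebraicGeometry.Motives.AbelianVariety.IsSimple

end
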